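import Summits.QuantumFields.YangMills.Theorems.BalabanLadderIRNoConformalOctave
import HarnessLib

/-!
# Line `no-conformal-octave` on crux `BalabanLadder.IR` (stmt-QuantumFields-19354) — lens «strengthen-to-induct», LINE 2, REV 3

Seat ym-ir-idea-14 g0 (planner, ideator; cell ym-ir; critic ym-ir-crit-4: PASS-WITH-PRICE 2026-08-28T03:29:31Z,
`run/shared/lean/pub/ym-ir/ym-ir-crit-4/VERDICT-no-conformal-octave.md`).  HONEST FRAMING: nothing in this file proves the
Yang–Mills mass gap (Clay), a lattice gap, or `BalabanLadder.IR`; R4 of the ladder closes only the conditional finite-𝕋⁴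
rung `BalabanLadder.UV`.  This is a conditional skeleton: sorries live ONLY in the `stub_*` theorems.

REV 3 (03:50Z): the sorry-free content of the line — the currency `renyiTwo` (+ `one_sub_coldDefect_pos`,
`coldDefect_le_renyiTwo`, `renyiTwo_nonneg`), the statements **D = `NoConformalOctaveSC`** (β-free per-octave dichotomy above a
floored scale: the `Q2`-floor advances by `κ` one octave toward the infrared below a ceiling, or from `1/s` on every aspect-4:1
octave loses `κ` nats of `S₂` or is `ε₀`-cold) and **U = `FlooredScaleBudgetSC`** (WINDOWED floored-scale entropy budget, per the
verdict §2), the PROVED seam `floorToPuritySC_of_dichotomy : D → U → ColdPurityBridge.FloorToPuritySC` (pigeonhole over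
`⌈(Q−ε)/κ⌉₊ + ⌈S/κ⌉₊` octaves) and the conditional composition `IR_of : D → U → IRnsc → Theses.BalabanLadder.IR` (via
`IR_of_handshake` + `AspectBootstrap.coldDoublingRecursionSC_holds` BY NAME) — LANDED as helper p602266
`Theorems/BalabanLadderIRNoConformalOctave.lean` (commit 083faca84523, RULING g9-№2, `--supports stmt-QuantumFields-19354 --as helper`).
This workfile now only carries the three stubs and their composition.  NOT registered (RULING g9-№1: `skeleton check` is the LEAD's).
PRICE (crit-4): D ⊋ H = census wall B7 in per-octave thermodynamic currency, width 0, count +1 vs row 13 (H ∧ N); U = REGIME:UV;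
N inherited.  Card: `Cruxes/IR/Lines/no-conformal-octave.md`; idea: `Cruxes/IR/Ideas/no-conformal-octave.md`.
-/

noncomputable section

open Summit.QuantumFields.YangMills.Cruxes.IR.ColdPressurePincer (IRnsc)

namespace Summit.QuantumFields.YangMills.Cruxes.IR.NoConformalOctave

/-- STUB D (the load, XL, β-uniform): no conformal octave above a floored scale (`NoConformalOctaveSC`, landed def). -/
theorem stub_noConformalOctave : NoConformalOctaveSC := by
  sorry

/-- STUB U (support-sized; UV-stability junction, WINDOWED): bounded entropy in `K` octaves above a floored scale
(`FlooredScaleBudgetSC`, landed def). -/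
theorem stub_flooredScaleBudget : FlooredScaleBudgetSC := by
  sorry

/-- STUB N (inherited, shared with lines 1/6/13/15): the non-simply-connected residual of `IR`. -/
theorem stub_irnsc : IRnsc := by
  sorry

/-- The stubs composed through the LANDED `IR_of` (sorried via the stubs; credits nothing). -/
theorem IR_of_stubs : Summit.QuantumFields.YangMills.Theses.BalabanLadder.IR :=
  IR_of stub_noConformalOctave stub_flooredScaleBudget stub_irnsc

end Summit.QuantumFields.YangMills.Cruxes.IR.NoConformalOctave

end
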